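/-
Copyright (c) 2026. All rights reserved.
Released under Apache 2.0 license as described in the file LICENSE.
-/
import Summits.HubbardSuperconductivity.HubbardLadder.Bounds.SectorVarianceBound
import HarnessLib

/-!
# Non-vanishing of the atomic partition function on an odd Fourier grid (bounds.tex §13, D5(b))

HONEST FRAMING: ladder R1–R4 with certified numbers; no claim on H/H₀. These are bounds for
MODEL CLASSES (the typed repulsive/attractive `t–t'` Hubbard torus with a flux twist), no
materials claim.

The conditional assembly of Theorem 13_N (#211.8 `norm_ttSectorZ_twist_sub_le`, and with it
#211.18/#211.19) carries the hypothesis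

`hz : ∀ k ∈ range M, atomicPartitionFn β U (fourierPoint M s k / β) ≠ 0`,

i.e. the one-site partition function `z(ζ) = 1 + 2e^{ζ} + e^{2ζ - βU}` does not vanish at the
`M` Fourier points `ζ_k = s + 2πik/M` of the fugacity circle `|e^{ζ}| = e^{s}`. This part
DISCHARGES it by an elementary location of the zeros of `z`:

* `atomicZC_ne_zero_of_cos_ne_neg_one` — writing `ζ = s + iθ`, `Im z = 2e^{s} sin θ (1 +
  e^{s-βU} cos θ)` and, on the branch `1 + e^{s-βU} cos θ = 0`, `Re z = 1 - e^{2s-βU}`; hence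
  `z(s + iθ) ≠ 0` as soon as `cos θ ≠ -1` AND (`βU ≥ 0` OR `s ≠ βU/2`). In words: for the
  REPULSIVE model (`U ≥ 0`, also `U = 0`) all zeros of `z` have `e^{ζ}` real negative (angle
  `π`); for the ATTRACTIVE model they lie on the single circle `|e^{ζ}| = e^{βU/2}`;
* `cos_fourierAngle_ne_neg_one` — an ODD `M` never produces the angle `π`:
  `cos (2πk/M) ≠ -1` for every `k` (parity);
* `atomicPartitionFn_fourierPoint_ne_zero` / `tt_hz_of_odd` — consequently `hz` holds for every
  odd `M`, every `β ≠ 0`, every `k`, under `0 ≤ βU ∨ s ≠ βU/2`; `exists_odd_gt` supplies an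
  odd `M` exceeding `n = |Orb Λ_L|` (and hence any sector label `N ≤ n`), as #211.8 requires.

NOT COVERED (stated, not hidden): the attractive model at the one radius `s = βU/2` (by
particle–hole symmetry this is the centred fugacity at HALF FILLING for `U < 0`); there the grid
must dodge the two zero angles `±φ*`, `cos φ* = -e^{βU/2}`, by the choice of `M` — successor
work if that case is wanted. No numerics, no `native_decide`; standard axioms only. References:
programme notes bounds.tex §13 (D5); C. N. Yang, T. D. Lee, Phys. Rev. 87 (1952) 404 (zeros of
grand partition functions in the fugacity plane) [YangLee1952].
-/

noncomputable section

namespace Summit.HubbardSuperconductivity.HubbardLadder.Bounds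

open Complex
open Literature.MathematicalPhysics.QuantumLattice

/-! ### The zeros of the one-site partition function -/

/-- `z(v, s + iθ)` in real coordinates: `z = A + iB` with
`A = 1 + 2e^{s} cos θ + e^{2s-v}(2cos²θ - 1)`, `B = 2e^{s} sin θ + e^{2s-v}(2 sin θ cos θ)`.
[this file] -/
theorem atomicZC_re_im (v s θ : ℝ) :
    atomicZC v ((s : ℂ) + (θ : ℂ) * I) =
      ((1 + 2 * Real.exp s * Real.cos θ + Real.exp (2 * s - v) * (2 * Real.cos θ ^ 2 - 1) : ℝ) :
          ℂ) +
        ((2 * Real.exp s * Real.sin θ + Real.exp (2 * s - v) * (2 * Real.sin θ * Real.cos θ) :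
            ℝ) : ℂ) * I := by
  have hE1 : cexp ((s : ℂ) + (θ : ℂ) * I) =
      ((Real.exp s : ℝ) : ℂ) * (((Real.cos θ : ℝ) : ℂ) + ((Real.sin θ : ℝ) : ℂ) * I) := by
    rw [Complex.exp_add, Complex.exp_mul_I, Complex.ofReal_exp, ← Complex.ofReal_cos,
      ← Complex.ofReal_sin]
  have hE2 : cexp (2 * ((s : ℂ) + (θ : ℂ) * I) - v) =
      ((Real.exp (2 * s - v) : ℝ) : ℂ) *
        (((Real.cos (2 * θ) : ℝ) : ℂ) + ((Real.sin (2 * θ) : ℝ) : ℂ) * I) := by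
    have h : 2 * ((s : ℂ) + (θ : ℂ) * I) - v =
        (((2 * s - v : ℝ)) : ℂ) + (((2 * θ : ℝ)) : ℂ) * I := by
      push_cast
      ring
    rw [h, Complex.exp_add, Complex.exp_mul_I, Complex.ofReal_exp, ← Complex.ofReal_cos,
      ← Complex.ofReal_sin]
  unfold atomicZC
  rw [hE1, hE2, Real.cos_two_mul, Real.sin_two_mul]
  push_cast
  ring

/-- Real and imaginary parts of `A + iB = 0` (`A`, `B` real). [this file] -/
theorem ofReal_add_ofReal_mul_I_eq_zero {A B : ℝ} (h : (A : ℂ) + (B : ℂ) * I = 0) :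
    A = 0 ∧ B = 0 := by
  have h1 := congrArg Complex.re h
  have h2 := congrArg Complex.im h
  simp at h1 h2
  exact ⟨h1, h2⟩

/-- **Location of the zeros of `z`.** If `cos θ ≠ -1` and (`0 ≤ v` or `s ≠ v/2`) then
`z(v, s + iθ) = 1 + 2e^{s+iθ} + e^{2(s+iθ) - v} ≠ 0`: the zeros of the one-site partition
function have `e^{ζ}` real negative when `v = βU ≥ 0`, and lie on the circle `Re ζ = v/2` when
`v < 0`. [YangLee1952 (fugacity-plane zeros); this file] -/
theorem atomicZC_ne_zero_of_cos_ne_neg_one (v s θ : ℝ) (hcos : Real.cos θ ≠ -1)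
    (h : 0 ≤ v ∨ s ≠ v / 2) : atomicZC v ((s : ℂ) + (θ : ℂ) * I) ≠ 0 := by
  intro hz
  rw [atomicZC_re_im] at hz
  obtain ⟨hA, hB⟩ := ofReal_add_ofReal_mul_I_eq_zero hz
  -- bookkeeping of exponentials: `d = e^{s-v}`
  have hs : Real.exp s = Real.exp v * Real.exp (s - v) := by
    rw [← Real.exp_add]; congr 1; ring
  have h2s : Real.exp (2 * s - v) = Real.exp v * Real.exp (s - v) ^ 2 := by
    rw [sq, ← Real.exp_add, ← Real.exp_add]; congr 1; ring
  have hv0 : 0 < Real.exp v := Real.exp_pos v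
  have hd0 : 0 < Real.exp (s - v) := Real.exp_pos (s - v)
  -- `Im z = 0`: `sin θ (1 + d cos θ) = 0`
  have hB' : Real.exp v * Real.exp (s - v) *
      (2 * (Real.sin θ * (1 + Real.exp (s - v) * Real.cos θ))) = 0 := by
    rw [hs, h2s] at hB
    linear_combination hB
  rcases mul_eq_zero.1 hB' with h0 | h1
  · exact (mul_pos hv0 hd0).ne' h0
  rcases mul_eq_zero.1 h1 with h0 | h1
  · norm_num at h0
  rcases mul_eq_zero.1 h1 with hsin | hc
  · -- `sin θ = 0`, so `cos θ = 1` (the angle `π` is excluded) and `Re z > 0`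
    have hc1 : (Real.cos θ - 1) * (Real.cos θ + 1) = 0 := by
      nlinarith [Real.sin_sq_add_cos_sq θ, hsin]
    rcases mul_eq_zero.1 hc1 with hc | hc
    · have hcos1 : Real.cos θ = 1 := by linarith
      rw [hcos1] at hA
      nlinarith [Real.exp_pos s, Real.exp_pos (2 * s - v)]
    · exact hcos (by linarith)
  · -- `1 + d cos θ = 0`: then `Re z = 1 - e^{2s-v}`, so `2s = v`
    have hR : Real.exp (2 * s - v) = 1 := by
      rw [hs, h2s] at hA
      rw [h2s]
      linear_combination -hA + (2 * Real.exp v * Real.exp (s - v) * Real.cos θ) * hc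
    have h2sv : 2 * s - v = 0 := (Real.exp_eq_one_iff _).1 hR
    rcases h with hv | hsv
    · -- `0 ≤ v = 2s`: `d = e^{-v/2} ≤ 1` forces `cos θ ≤ -1`, i.e. the excluded angle `π`
      have hd1 : Real.exp (s - v) ≤ 1 := Real.exp_le_one_iff.2 (by linarith)
      have hle : Real.cos θ ≤ -1 := by nlinarith [Real.neg_one_le_cos θ]
      exact hcos (le_antisymm hle (Real.neg_one_le_cos θ))
    · exact hsv (by linarith)

/-! ### Odd Fourier grids miss the angle `π` -/

/-- **An odd grid misses `π`**: `cos (2πk/M) ≠ -1` for `M` odd and every `k : ℕ` (if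
`2πk/M = π + 2πm` then `2k = M(2m+1)`, even = odd). [this file] -/
theorem cos_fourierAngle_ne_neg_one {M : ℕ} (hM : Odd M) (k : ℕ) :
    Real.cos (2 * Real.pi * k / M) ≠ -1 := by
  intro h
  obtain ⟨m, hm⟩ := Real.cos_eq_neg_one_iff.1 h
  have hM0 : (M : ℝ) ≠ 0 := by exact_mod_cast hM.pos.ne'
  have h3 : 2 * Real.pi * k = (Real.pi + m * (2 * Real.pi)) * M := by
    rw [← div_eq_iff hM0]; exact hm.symm
  have h4 : Real.pi * ((M : ℝ) * (1 + 2 * m)) = Real.pi * (2 * k) := by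
    linear_combination -h3
  have h5 : (M : ℝ) * (1 + 2 * m) = 2 * k := mul_left_cancel₀ Real.pi_ne_zero h4
  have h6 : (M : ℤ) * (1 + 2 * m) = 2 * k := by exact_mod_cast h5
  have ho : Odd ((M : ℤ) * (1 + 2 * m)) := hM.natCast.mul ⟨m, by ring⟩
  have he : Even ((M : ℤ) * (1 + 2 * m)) := by
    rw [h6]; exact even_two_mul _
  exact (Int.not_even_iff_odd.2 ho) he

/-- An odd `M` exceeding a given bound exists (`M = 2n + 1`). [this file] -/
theorem exists_odd_gt (n : ℕ) : ∃ M : ℕ, Odd M ∧ n < M :=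
  ⟨2 * n + 1, odd_two_mul_add_one n, by omega⟩

/-! ### The hypothesis `hz` of Theorem 13_N -/

/-- The Fourier points in real coordinates: `ζ_k = s + i (2πk/M)`. [this file] -/
theorem fourierPoint_ofReal (M : ℕ) (s : ℝ) (k : ℕ) :
    fourierPoint M (s : ℂ) k = (s : ℂ) + ((2 * Real.pi * k / M : ℝ) : ℂ) * I := by
  unfold fourierPoint
  push_cast
  ring

/-- **`z₀(β, U, ζ_k/β) ≠ 0` on every odd Fourier grid** (`β ≠ 0`; `0 ≤ βU`, or any
`s ≠ βU/2`). [this file] -/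
theorem atomicPartitionFn_fourierPoint_ne_zero {β : ℝ} (hβ : β ≠ 0) (U s : ℝ) {M : ℕ}
    (hM : Odd M) (h : 0 ≤ β * U ∨ s ≠ β * U / 2) (k : ℕ) :
    atomicPartitionFn (β : ℂ) (U : ℂ) (fourierPoint M (s : ℂ) k / β) ≠ 0 := by
  rw [atomicPartitionFn_div_eq_atomicZC β U hβ, fourierPoint_ofReal]
  exact atomicZC_ne_zero_of_cos_ne_neg_one (β * U) s _ (cos_fourierAngle_ne_neg_one hM k) h

/-- **THE HYPOTHESIS `hz` OF #211.8 / #211.18 / #211.19, DISCHARGED**: for odd `M`, `β ≠ 0` and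
(`0 ≤ βU` or `s ≠ βU/2`), `∀ k ∈ range M, z₀(β, U, ζ_k/β) ≠ 0`. For the repulsive model
(`U ≥ 0`, `β > 0`) this is unconditional in `s`; any odd `M > n` (`exists_odd_gt`) then serves
in Theorem 13_N. [programme: bounds.tex §13, D5(b); this file] -/
theorem tt_hz_of_odd {β : ℝ} (hβ : β ≠ 0) (U s : ℝ) {M : ℕ} (hM : Odd M)
    (h : 0 ≤ β * U ∨ s ≠ β * U / 2) :
    ∀ k ∈ Finset.range M, atomicPartitionFn (β : ℂ) (U : ℂ) (fourierPoint M (s : ℂ) k / β) ≠ 0 :=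
  fun k _ => atomicPartitionFn_fourierPoint_ne_zero hβ U s hM h k

/-- The repulsive case packaged for Theorem 13_N: `0 < β`, `0 ≤ U`, `M` odd. [this file] -/
theorem tt_hz_of_odd_repulsive {β : ℝ} (hβ : 0 < β) {U : ℝ} (hU : 0 ≤ U) (s : ℝ) {M : ℕ}
    (hM : Odd M) :
    ∀ k ∈ Finset.range M, atomicPartitionFn (β : ℂ) (U : ℂ) (fourierPoint M (s : ℂ) k / β) ≠ 0 :=
  tt_hz_of_odd hβ.ne' U s hM (Or.inl (mul_nonneg hβ.le hU))

end Summit.HubbardSuperconductivity.HubbardLadder.Bounds
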